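import Summits.ResolutionOfSingularities.ResolutionOfSingularities.Theorems.FrobeniusClosingPatchingRelPerfectDepthPhaseCContactEndSncLift
import Summits.ResolutionOfSingularities.ResolutionOfSingularities.Theorems.FrobeniusClosingPatchingRelPerfectDepthPhaseCContactEndFormula
import HarnessLib

/-!
# Crux `PatchingRelPerfect` (stmt-ResolutionOfSingularities-16161), chain W5.2 — F7(β) (β-AX) X3 C-I (M2b-T) (T-c), assembled:
# the END of the contact transport feeds the carrier game (CE1 with ambient letters)

[OURS · L1 W5.2 · F7(β) (β-AX) X3 C-I (M2b-T) (T-c) · res-D-pv-034 AS res-L1-s36-pv-3 per DESK WORD 20:05:57Z (G12-29/G12-32).]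
Replaces the role of NO printed item; NOT a statement of the manuscript under review; fact-free, def-free.  AI-written; AI review
is weaker than expert review.

On the end patch `X` (regular, locally Noetherian): carrier `G` (regular hypersurface, `G ≤ K`), boundary letters `𝓑` and the strict
transform letter `Φ` with `(𝓑 ++ [Φ]).Nodup`, `G ∉ 𝓑 ++ [Φ]`, principal letter stalks along `V(G)`, letters separated by their traces,
the TRACES snc on `V(G)` (F-60's output read through the dictionary) and the letters snc off `V(G)` on the patch, and the END formula
`K = G·𝓜(M₁) ⊔ Φ·𝓜(M₂) ⊔ 𝓜(M₃)` (tri-2 K16): then the carrier game runs — `carrierGameLift_of_ambientLetters` (p563491) with the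
binders produced by `hasSNC_cons_of_traces` (SNC LIFT) and `comap_subschemeι_eq_monomialSum_of_end_formula` (TRACE IDENTITY).

* **`carrierGameLift_of_traces`**.
-/

-- `Summit.<Summit>.<Sub>.Theorems` with `Sub = Summit` (single-conjunct summit, D-0017)
set_option linter.dupNamespace false

noncomputable section

open CategoryTheory AlgebraicGeometry TopologicalSpace IsLocalRing
open Literature.AlgebraicGeometry.Resolution
open Scheme.IdealSheafData

namespace Summit.ResolutionOfSingularities.ResolutionOfSingularities.Theorems.DepthMultiHost

open DepthTargets (monomialSum)
open MonomialCleanup (PointedDistinct)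

universe u

variable {X : Scheme.{u}} [IsLocallyNoetherian X]

omit [IsLocallyNoetherian X] in
/-- [OURS · L1 W5.2 · (T-c)] **The separation hypothesis `hsep` from injectivity of the trace map**: if distinct letters have
distinct TRACES (as ideal sheaves of `V(G)`) and the traces are snc on `V(G)`, then letters through a point of `V(G)` with
`L_x + G_x = L′_x + G_x` coincide (distinct snc members through a point have distinct stalks). [cite: Matsumura1987, Thm. 14.2] -/
theorem sep_of_injOn_comap_subschemeι (G : X.IdealSheafData) (𝓛 : List X.IdealSheafData)
    (hinj : ∀ L ∈ 𝓛, ∀ L' ∈ 𝓛, L.comap G.subschemeι = L'.comap G.subschemeι → L = L')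
    (htr : HasSNC (𝓛.map fun L => L.comap G.subschemeι)) :
    ∀ L ∈ 𝓛, ∀ L' ∈ 𝓛, ∀ x ∈ G.support, x ∈ L.support → x ∈ L'.support →
      stalkIdeal L x ⊔ stalkIdeal G x = stalkIdeal L' x ⊔ stalkIdeal G x → L = L' := by
  intro L hL L' hL' x hx hxL hxL' heq
  by_contra hne
  obtain ⟨s, rfl⟩ : x ∈ Set.range G.subschemeι := by rw [range_subschemeι]; exact hx
  -- the traces are distinct members through `s`, hence have distinct (non-associated) stalk generators
  have hne' : L.comap G.subschemeι ≠ L'.comap G.subschemeι := fun h => hne (hinj L hL L' hL' h)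
  obtain ⟨hB, u, hu, ⟨ι, hιinj, hι⟩, -⟩ := htr s
  haveI := hB
  have hmem : ∀ M : X.IdealSheafData, G.subschemeι s ∈ M.support → s ∈ (M.comap G.subschemeι).support := fun M h => by
    rw [support_comap]; exact h
  let D₁ : {D // D ∈ 𝓛.map (fun L => L.comap G.subschemeι) ∧ s ∈ D.support} :=
    ⟨L.comap G.subschemeι, List.mem_map.mpr ⟨L, hL, rfl⟩, hmem L hxL⟩
  let D₂ : {D // D ∈ 𝓛.map (fun L => L.comap G.subschemeι) ∧ s ∈ D.support} :=
    ⟨L'.comap G.subschemeι, List.mem_map.mpr ⟨L', hL', rfl⟩, hmem L' hxL'⟩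
  have hD : D₁ ≠ D₂ := fun h => hne' (congrArg Subtype.val h)
  have hιne : ι D₁ ≠ ι D₂ := fun h => hD (hιinj h)
  -- equal ambient data give equal trace stalks
  have htrace : ∀ M : X.IdealSheafData, stalkIdeal (M.comap G.subschemeι) s =
      (stalkIdeal M (G.subschemeι s) ⊔ stalkIdeal G (G.subschemeι s)).map (G.subschemeι.stalkMap s).hom := fun M => by
    rw [stalkIdeal_comap_eq_map_stalkMap, Ideal.map_sup]
    conv_lhs => rw [← sup_bot_eq ((stalkIdeal M (G.subschemeι s)).map _)]
    congr 1
    rw [eq_comm, ← le_bot_iff, Ideal.map_le_iff_le_comap, ← RingHom.ker_eq_comap_bot,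
      ker_stalkMap_of_isClosedImmersion G.subschemeι s, ker_subschemeι]
  have hst : stalkIdeal (L.comap G.subschemeι) s = stalkIdeal (L'.comap G.subschemeι) s := by
    rw [htrace, htrace, heq]
  have h1 : Ideal.span {u (ι D₁)} = Ideal.span {u (ι D₂)} := by
    rw [← hι D₁, ← hι D₂]; exact hst
  have hrsop : IsRsopPart (u ∘ id) := isRsopPart_comp_of_rsop rfl u hu id Function.injective_id
  haveI := isDomain_of_isRegularLocalRing ((G.subscheme).presheaf.stalk s)
  rw [Ideal.span_singleton_eq_span_singleton] at h1
  exact hrsop.not_associated (i := ι D₁) (j := ι D₂) hιne h1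

/-- [OURS · L1 W5.2 · (T-c) assembled] **The end of the contact transport feeds CE1**: from the traces-snc data on the carrier, the
letters snc off the carrier, and the END formula, some multiple blow-up of the patch with regular centres over `cosupp K` and regular
top makes `K𝒪_top` an effective Cartier divisor. [cite: Kollar2007, Cor. 3.85, (3.111) Step 3] -/
theorem carrierGameLift_of_traces (hX : Scheme.IsRegular X) {K G : X.IdealSheafData} (hGK : G ≤ K)
    (hGhyp : ∀ x ∈ G.support, ∃ v : X.presheaf.stalk x,
      stalkIdeal G x = Ideal.span {v} ∧ v ∉ (maximalIdeal (X.presheaf.stalk x)) ^ 2)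
    (𝓑 : List X.IdealSheafData) (Φ : X.IdealSheafData) (hnodup : (𝓑 ++ [Φ]).Nodup) (hG𝓛 : G ∉ 𝓑 ++ [Φ])
    (hL : ∀ L ∈ 𝓑 ++ [Φ], ∀ x ∈ G.support, x ∈ L.support → ∃ f : X.presheaf.stalk x, stalkIdeal L x = Ideal.span {f})
    (hsep : ∀ L ∈ 𝓑 ++ [Φ], ∀ L' ∈ 𝓑 ++ [Φ], ∀ x ∈ G.support, x ∈ L.support → x ∈ L'.support →
      stalkIdeal L x ⊔ stalkIdeal G x = stalkIdeal L' x ⊔ stalkIdeal G x → L = L')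
    (htr : HasSNC ((𝓑 ++ [Φ]).map fun L => L.comap G.subschemeι))
    (hoff : ∀ x ∉ G.support, IsRegularLocalRing (X.presheaf.stalk x) ∧
      ∃ u : Fin (maximalIdeal (X.presheaf.stalk x)).spanFinrank → X.presheaf.stalk x,
        Ideal.span (Set.range u) = maximalIdeal (X.presheaf.stalk x) ∧
        ∃ ι : {D // D ∈ 𝓑 ++ [Φ] ∧ x ∈ D.support} → Fin (maximalIdeal (X.presheaf.stalk x)).spanFinrank,
          Function.Injective ι ∧ ∀ D, stalkIdeal D.1 x = Ideal.span {u (ι D)})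
    (M₁ M₂ M₃ : List (X.IdealSheafData × ℕ)) (hb₂ : boundaryOf M₂ = 𝓑) (hb₃ : boundaryOf M₃ = 𝓑)
    (hK : K = G * monomialIdeal M₁ ⊔ Φ * monomialIdeal M₂ ⊔ monomialIdeal M₃) :
    ∃ t : CentreSeq X, t.AllRegular ∧ t.CentresOver (K.support : Set X) ∧ Scheme.IsRegular t.top ∧
      IsEffectiveCartier (K.comap t.comp) := by
  obtain ⟨hJ, hbd, h𝒦⟩ := comap_subschemeι_eq_monomialSum_of_end_formula G Φ K M₁ M₂ M₃ 𝓑 hb₂ hb₃ hK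
  exact carrierGameLift_of_ambientLetters hX hGK hGhyp (𝓑 ++ [Φ])
    (hasSNC_cons_of_traces hX G hGhyp (𝓑 ++ [Φ]) hL hsep htr hoff) hG𝓛 (PointedDistinct.of_nodup hnodup) _ hbd h𝒦 hJ

/-- [OURS · L1 W5.2 · (T-c) → END GLUE] **The end of the contact transport ON A PATCH ⇒ the `PhaseCOne` conclusion**:
`MultiHostState.phaseCOne_conclusion_of_local_ambientLetters` (p563491's file) with its `hsnc`/`hpd`/`𝒦` binders produced from the
traces-snc data, the letters snc off the carrier, trace-injectivity and the END formula on the patch `X₀ ⊇ cosupp K♭`.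
[cite: Kollar2007, (3.111) Step 3] [cite: GortzWedhorn2020, Prop. 13.91 (1)–(2)] -/
theorem MultiHostState.phaseCOne_conclusion_of_local_traces {X X₀ : Scheme.{u}} [IsNoetherian X] [IsIntegral X]
    (hX : Scheme.IsRegular X) (S₁ : MultiHostState X) (hn : S₁.n ≠ 0) (hK0 : S₁.residual.K ≠ ⊥)
    (j : X₀ ⟶ X) [IsOpenImmersion j] (hZj : (S₁.residual.K.support : Set X) ⊆ Set.range j.base)
    {G₀ : X₀.IdealSheafData} (hGK : G₀ ≤ S₁.residual.K.comap j)
    (hGhyp : ∀ x ∈ G₀.support, ∃ v : X₀.presheaf.stalk x,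
      stalkIdeal G₀ x = Ideal.span {v} ∧ v ∉ (maximalIdeal (X₀.presheaf.stalk x)) ^ 2)
    (𝓑 : List X₀.IdealSheafData) (Φ : X₀.IdealSheafData) (hnodup : (𝓑 ++ [Φ]).Nodup) (hG𝓛 : G₀ ∉ 𝓑 ++ [Φ])
    (hL : ∀ L ∈ 𝓑 ++ [Φ], ∀ x ∈ G₀.support, x ∈ L.support → ∃ f : X₀.presheaf.stalk x, stalkIdeal L x = Ideal.span {f})
    (hinj : ∀ L ∈ 𝓑 ++ [Φ], ∀ L' ∈ 𝓑 ++ [Φ], L.comap G₀.subschemeι = L'.comap G₀.subschemeι → L = L')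
    (htr : HasSNC ((𝓑 ++ [Φ]).map fun L => L.comap G₀.subschemeι))
    (hoff : ∀ x ∉ G₀.support, IsRegularLocalRing (X₀.presheaf.stalk x) ∧
      ∃ u : Fin (maximalIdeal (X₀.presheaf.stalk x)).spanFinrank → X₀.presheaf.stalk x,
        Ideal.span (Set.range u) = maximalIdeal (X₀.presheaf.stalk x) ∧
        ∃ ι : {D // D ∈ 𝓑 ++ [Φ] ∧ x ∈ D.support} → Fin (maximalIdeal (X₀.presheaf.stalk x)).spanFinrank,
          Function.Injective ι ∧ ∀ D, stalkIdeal D.1 x = Ideal.span {u (ι D)})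
    (M₁ M₂ M₃ : List (X₀.IdealSheafData × ℕ)) (hb₂ : boundaryOf M₂ = 𝓑) (hb₃ : boundaryOf M₃ = 𝓑)
    (hK : S₁.residual.K.comap j = G₀ * monomialIdeal M₁ ⊔ Φ * monomialIdeal M₂ ⊔ monomialIdeal M₃) :
    ∃ (s : CentreSeq X), s.AllRegular ∧ s.CentresOver (S₁.K.support : Set X) ∧ Scheme.IsRegular s.top ∧
      ∃ (_ : IsNoetherian s.top) (M : s.top.IdealSheafData) (S₂ : MultiHostState s.top),
        S₁.K.comap s.comp = M * S₂.K ∧ IsEffectiveCartier M ∧ S₂.n ≠ 0 ∧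
        ∃ (U : s.top.Opens), S₂.residual.IsEndOn U := by
  haveI : IsLocallyNoetherian X₀ := LocallyOfFiniteType.isLocallyNoetherian j
  have hX₀ : Scheme.IsRegular X₀ := Scheme.IsRegular.of_isOpenImmersion j hX
  obtain ⟨hJ, hbd, h𝒦⟩ := comap_subschemeι_eq_monomialSum_of_end_formula G₀ Φ _ M₁ M₂ M₃ 𝓑 hb₂ hb₃ hK
  exact S₁.phaseCOne_conclusion_of_local_ambientLetters hX hn hK0 j hZj hGK hGhyp (𝓑 ++ [Φ])
    (hasSNC_cons_of_traces hX₀ G₀ hGhyp (𝓑 ++ [Φ]) hL (sep_of_injOn_comap_subschemeι G₀ _ hinj htr) htr hoff)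
    hG𝓛 (PointedDistinct.of_nodup hnodup) _ hbd h𝒦 hJ

end Summit.ResolutionOfSingularities.ResolutionOfSingularities.Theorems.DepthMultiHost

end
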